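import Summits.QuantumFields.QCD.Theses.OverlapPositivityTransfer

/-!
# Birth skeleton — piece C `OverlapRotationRestoration` of the decomposition of `OverlapContinuumLimit`

Line: SYMANZIK ROTATION DEFECT + CLOSURE.  `stub_rotationDefect` (hard, O(4) restoration at lattice level):
along an asymptotically scaling admissible-overlap scheme whose renormalised Schwinger functions converge on
off-diagonal real tensors, the defect between the `n`-point function of the ROTATED real tensor
(`linActTest R (f i)`, `R ∈ SO(4)`) and the original tends to `0` (hypercubic artefacts are `a_k²` ×
dimension-6 insertions with k-uniform bounds; overlap quarks are automatically `O(a)`-improved).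
`stub_rotationClosure` (soft: `linActMulti R` of a real tensor is the tensor of the rotated factors —
`IsTensorOf.linActMulti` —, off-diagonality is rotation stable, density of off-diagonal real tensors in `⁰𝒮`,
continuity of `S`, arity `0` trivial): vanishing defects give proper-rotation invariance of the limit on `⁰𝒮`.
`OverlapRotationRestoration_of` composes.
-/

namespace Summit.QuantumFields.QCD.Cruxes.OverlapRotationRestoration.Birth

open scoped BigOperators Topology ComplexConjugate
open Filter
open Literature.MathematicalPhysics.QuantumFieldTheory Literature.MathematicalPhysics.QuantumLattice
  Literature.MathematicalPhysics.AQFT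
open Summit.QuantumFields.QCD.Theses.OverlapPositivityTransfer

/-- ROTATION DEFECT (hard): hypercubic artefacts of the renormalised overlap functions vanish. -/
theorem stub_rotationDefect : ∀ Nf : ℕ, Nf = 2 ∨ Nf = 3 → ∀ sch : QCDScheme Nf, sch.HasAsymptoticScaling → (∀ fl : Fin Nf, ∀ᶠ k in Filter.atTop, 0 < sch.mq fl k ∧ sch.mq fl k < 2) → (∃ Δ : ℝ, 0 < Δ ∧ sch.OverlapHasLatticeMassGap Δ) → (∀ n : ℕ, n ≠ 0 → ∀ (σ : Fin n → QCDField Nf) (f : Fin n → SchwartzMap (EuclideanSpace ℝ (Fin 4)) ℝ) (F : SchwartzMap (Fin n → EuclideanSpace ℝ (Fin 4)) ℂ), IsTensorOf F (fun i => ofRealTest (f i)) → IsOffDiagonal F → ∃ c : ℂ, Filter.Tendsto (fun k : ℕ => overlapLatticeSchwinger sch k n σ f) Filter.atTop (nhds c)) → (∀ n : ℕ, n ≠ 0 → ∀ (σ : Fin n → QCDField Nf) (f : Fin n → SchwartzMap (EuclideanSpace ℝ (Fin 4)) ℝ) (R : EuclideanSpace ℝ (Fin 4) ≃ₗᵢ[ℝ]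 EuclideanSpace ℝ (Fin 4)), LinearMap.det (R.toLinearEquiv : EuclideanSpace ℝ (Fin 4) →ₗ[ℝ] EuclideanSpace ℝ (Fin 4)) = 1 → ∀ F : SchwartzMap (Fin n → EuclideanSpace ℝ (Fin 4)) ℂ, IsTensorOf F (fun i => ofRealTest (f i)) → IsOffDiagonal F → Filter.Tendsto (fun k : ℕ => overlapLatticeSchwinger sch k n σ (fun i => linActTest R (f i)) - overlapLatticeSchwinger sch k n σ f) Filter.atTop (nhds 0)) := by
  sorry

/-- CLOSURE (soft): vanishing defects on off-diagonal real tensors give rotation invariance of the limit. -/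
theorem stub_rotationClosure : ∀ (Nf : ℕ) (sch : QCDScheme Nf) (S : LabelledSchwingerFamily (QCDField Nf) (EuclideanSpace ℝ (Fin 4))), (∀ n : ℕ, n ≠ 0 → ∀ (σ : Fin n → QCDField Nf) (f : Fin n → SchwartzMap (EuclideanSpace ℝ (Fin 4)) ℝ) (F : SchwartzMap (Fin n → EuclideanSpace ℝ (Fin 4)) ℂ), IsTensorOf F (fun i => ofRealTest (f i)) → IsOffDiagonal F → Filter.Tendsto (fun k : ℕ => overlapLatticeSchwinger sch k n σ f) Filter.atTop (nhds (S n σ F))) → (∀ n : ℕ, n ≠ 0 → ∀ (σ : Fin n → QCDField Nf) (f : Fin n → SchwartzMap (EuclideanSpace ℝ (Fin 4)) ℝ) (R : EuclideanSpace ℝ (Fin 4) ≃ₗᵢ[ℝ] EuclideanSpace ℝ (Fin 4)), LinearMap.det (R.toLinearEquiv : EuclideanSpace ℝ (Fin 4) →ₗ[ℝ] EuclideanSpace ℝ (Fin 4)) = 1 → ∀ F : SchwartzMap (Fin n → EuclideanSpace ℝ (Fin 4)) ℂ, IsTensorOf F (fun i => ofRealTest (f i)) → IsOffDiagonal F → Filter.Tendsto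 (fun k : ℕ => overlapLatticeSchwinger sch k n σ (fun i => linActTest R (f i)) - overlapLatticeSchwinger sch k n σ f) Filter.atTop (nhds 0)) → (∀ (n : ℕ) (σ : Fin n → QCDField Nf) (R : EuclideanSpace ℝ (Fin 4) ≃ₗᵢ[ℝ] EuclideanSpace ℝ (Fin 4)), LinearMap.det (R.toLinearEquiv : EuclideanSpace ℝ (Fin 4) →ₗ[ℝ] EuclideanSpace ℝ (Fin 4)) = 1 → ∀ F : SchwartzMap (Fin n → EuclideanSpace ℝ (Fin 4)) ℂ, IsOffDiagonal F → S n σ (linActMulti R F) = S n σ F) := by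
  sorry

/-- Composition (pure logic): vanishing rotation defects + closure give piece C. -/
theorem OverlapRotationRestoration_of :
    Summit.QuantumFields.QCD.Theses.OverlapPositivityTransfer.OverlapRotationRestoration := by
  intro Nf hNf sch S hAF hwin hgap hconv
  have hc : (∀ n : ℕ, n ≠ 0 → ∀ (σ : Fin n → QCDField Nf) (f : Fin n → SchwartzMap (EuclideanSpace ℝ (Fin 4)) ℝ) (F : SchwartzMap (Fin n → EuclideanSpace ℝ (Fin 4)) ℂ), IsTensorOf F (fun i => ofRealTest (f i)) → IsOffDiagonal F → ∃ c : ℂ, Filter.Tendsto (fun k : ℕ => overlapLatticeSchwinger sch k n σ f) Filter.atTop (nhds c)) :=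
    fun n hn σ f F hF hoff => ⟨S n σ F, hconv n hn σ f F hF hoff⟩
  exact stub_rotationClosure Nf sch S hconv (stub_rotationDefect Nf hNf sch hAF hwin hgap hc)

end Summit.QuantumFields.QCD.Cruxes.OverlapRotationRestoration.Birth
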